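import Summits.Ventures.HSemireg.WedgeHankelRecurrenceSignatureSturm

/-!
# Venture HSemireg — COUNTING REAL ROOTS IN AN INTERVAL BY TWO HERMITE SIGNATURES: for `P ∈ ℝ[X]` monic with `deg P ≤ t + 1` and `a ≤ b` in `ℝ`, with `Q_{a,b} = (X − a)(b − X)`,
# **`2 · #{x ∈ roots_ℝ(P) | a < x < b} = Sign H_t(Q_{a,b}²·P′/P) + Sign H_t(Q_{a,b}·P′/P)`**, and for `P(a) ≠ 0`: **`2 · #{x ∈ roots_ℝ(P) | x > a} = Sign H_t(P′/P) + Sign H_t((X − a)·P′/P)`** — the Tarski queries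
# `TaQ(Q², P) ± TaQ(Q, P)` isolate the sign conditions, each query being a Hankel signature by N129

HONEST FRAMING. Part of the Lean index of the computation cell `pub-hsemireg` (seat p10 gen 33, Sunday typer «UNIFORM-IN-n»).
LINEAR ALGEBRA OF HANKEL (catalecticant) MATRICES and of real polynomials ONLY (Mathlib's `sigPos` ∕ `sigNeg`, `Polynomial.roots`): no variety, no cohomology theory, no sheaf, no Ext group and no semiregularity map is
constructed here; nothing here says that HC / HC_CM / HC_AV holds; no Literature fact is declared or used.
SOURCE (classical): S. Basu, R. Pollack, M.-F. Roy, *Algorithms in Real Algebraic Geometry* (2nd ed. 2006), §2.2.2 (the sign conditions realised by `Q` on `Zer(P, R)` are computed from the Tarski queries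
`TaQ(1, P)`, `TaQ(Q, P)`, `TaQ(Q², P)` — the `3 × 3` system behind Algorithm 10.11 (Sign Determination)) combined with §4.3.2 Theorem 4.57 (each `TaQ` is a Hermite signature); the interval count via
`Q = (X − a)(b − X)` is the textbook special case.
DEDUP DISCLOSURE (`rg` of the whole tree): PROVED Literature `Algebra/Polynomial/SignDetermination*.lean` ∕ `UnivariateSignDetermination.lean` formalise BPR's sign determination with Tarski queries computed by SIGNED
REMAINDER SEQUENCES (`signedRemVar`), and `SturmTheorem.lean` counts roots in `(a, b]` by Sturm sequences; the statements below express the interval ∕ half-line counts through HANKEL SIGNATURES (N128 ∕ N129) and are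
not in the tree.

WHAT IS IN THE TREE.  N129 (`WedgeHankelRecurrenceSignatureSturm`): `sigPos_sub_sigNeg_hankelSq_dualSeq_mul_derivative_real` (`Sign H_t(Q·P′/P) = Σ_{x ∈ roots_ℝ(P)} sign Q(x)`),
`sigPos_sub_sigNeg_hankelSq_dualSeq_derivative_real`.  Mathlib: `sign_pos` ∕ `sign_neg` ∕ `sign_zero`, `sign_mul`, `Finset.card_filter`, `Finset.sum_add_distrib`.
THIS FILE (namespace `Summit.Ventures.HSemireg.Wedge.HankelOuter` continued; CHAINED on N129; 0 definitions):
* §716 `sign_sq_add_sign` (`sign(q²) + sign q = 2·[q > 0]`), `sign_one_add_sign` (`q ≠ 0 ⇒ 1 + sign q = 2·[q > 0]`), **`two_mul_card_roots_filter_pos_eq`** (`2·#{x ∈ roots_ℝ(P) | Q(x) > 0} = Sign H_t(Q²P′/P) + Sign H_t(QP′/P)`,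
  any `Q`), **`two_mul_card_roots_Ioo_eq`** (`Q = (X − a)(b − X)`: roots in the open interval), **`two_mul_card_roots_filter_pos_eq_of_forall_ne`** (`Q ≠ 0` on the roots: `= Sign H_t(P′/P) + Sign H_t(QP′/P)`),
  **`two_mul_card_roots_Ioi_eq`** (`Q = X − a`, `P(a) ≠ 0`: roots `> a`), `two_mul_card_roots_Iio_eq` (roots `< a`).
Nothing Ext-side.  New names only.
-/

open Module Polynomial
open scoped Matrix Polynomial

namespace Summit.Ventures.HSemireg.Wedge.HankelOuter

open Summit.Ventures.HSemireg.Wedge Summit.Ventures.HSemireg.Wedge.Hankel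

/-! ## §716. Sign conditions on the real roots from pairs of Hermite signatures -/

/-- `sign(q²) + sign(q) = 2·[q > 0]` in an ordered field (as integers). [bookkeeping] -/
theorem sign_sq_add_sign {K : Type*} [Field K] [LinearOrder K] [IsStrictOrderedRing K] (q : K) :
    (SignType.sign (q ^ 2) : ℤ) + SignType.sign q = if 0 < q then 2 else 0 := by
  rcases lt_trichotomy 0 q with h | h | h
  · rw [sign_pos (pow_pos h 2), sign_pos h, if_pos h]; rfl
  · rw [← h, if_neg (lt_irrefl 0)]; simp
  · rw [sign_pos (lt_of_le_of_ne (sq_nonneg q) (Ne.symm (pow_ne_zero 2 h.ne))), sign_neg h, if_neg (not_lt.2 h.le)]; rfl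

/-- `q ≠ 0 ⇒ 1 + sign(q) = 2·[q > 0]`. [bookkeeping] -/
theorem one_add_sign_of_ne_zero {K : Type*} [Field K] [LinearOrder K] [IsStrictOrderedRing K] {q : K} (hq : q ≠ 0) :
    (1 : ℤ) + SignType.sign q = if 0 < q then 2 else 0 := by
  rcases lt_trichotomy 0 q with h | h | h
  · rw [sign_pos h, if_pos h]; rfl
  · exact absurd h.symm hq
  · rw [sign_neg h, if_neg (not_lt.2 h.le)]; rfl

/-- **`2·#{x ∈ roots_ℝ(P) | Q(x) > 0} = Sign H_t(Q²·P′/P) + Sign H_t(Q·P′/P)`** for `P` monic real with `deg P ≤ t + 1` and ANY `Q` (the Tarski queries `TaQ(Q², P) + TaQ(Q, P)`, each a Hermite signature by N129).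
[this file, §716] -/
theorem two_mul_card_roots_filter_pos_eq {t : ℕ} {P : ℝ[X]} (hP : P.Monic) (hPd : P.natDegree ≤ t + 1) (Q : ℝ[X]) :
    (2 * (P.roots.toFinset.filter fun x => 0 < Q.eval x).card : ℤ)
      = ((sigPos (hankelSq ℝ t (dualSeq ℝ P (Q ^ 2 * derivative P))).toQuadraticForm' : ℤ) - sigNeg (hankelSq ℝ t (dualSeq ℝ P (Q ^ 2 * derivative P))).toQuadraticForm')
        + ((sigPos (hankelSq ℝ t (dualSeq ℝ P (Q * derivative P))).toQuadraticForm' : ℤ) - sigNeg (hankelSq ℝ t (dualSeq ℝ P (Q * derivative P))).toQuadraticForm') := by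
  rw [sigPos_sub_sigNeg_hankelSq_dualSeq_mul_derivative_real hP hPd, sigPos_sub_sigNeg_hankelSq_dualSeq_mul_derivative_real hP hPd, ← Finset.sum_add_distrib, Finset.card_filter, Nat.cast_sum,
    Finset.mul_sum]
  refine Finset.sum_congr rfl fun x _ => ?_
  rw [eval_pow, sign_sq_add_sign]
  split_ifs <;> simp

/-- **Roots in an open interval: `2·#{x ∈ roots_ℝ(P) | a < x < b} = Sign H_t(Q²·P′/P) + Sign H_t(Q·P′/P)` with `Q = (X − a)(b − X)`, `a ≤ b`** (`P` monic real, `deg P ≤ t + 1`; for `b < a` the same signatures count the roots in `(b, a)`). [this file, §716] -/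
theorem two_mul_card_roots_Ioo_eq {t : ℕ} {P : ℝ[X]} (hP : P.Monic) (hPd : P.natDegree ≤ t + 1) {a b : ℝ} (hab : a ≤ b) :
    (2 * (P.roots.toFinset.filter fun x => a < x ∧ x < b).card : ℤ)
      = ((sigPos (hankelSq ℝ t (dualSeq ℝ P (((Polynomial.X - C a) * (C b - Polynomial.X)) ^ 2 * derivative P))).toQuadraticForm' : ℤ)
            - sigNeg (hankelSq ℝ t (dualSeq ℝ P (((Polynomial.X - C a) * (C b - Polynomial.X)) ^ 2 * derivative P))).toQuadraticForm')
        + ((sigPos (hankelSq ℝ t (dualSeq ℝ P (((Polynomial.X - C a) * (C b - Polynomial.X)) * derivative P))).toQuadraticForm' : ℤ)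
            - sigNeg (hankelSq ℝ t (dualSeq ℝ P (((Polynomial.X - C a) * (C b - Polynomial.X)) * derivative P))).toQuadraticForm') := by
  rw [← two_mul_card_roots_filter_pos_eq hP hPd]
  congr 3
  refine Finset.filter_congr fun x _ => ?_
  rw [eval_mul, eval_sub, eval_sub, eval_X, eval_C, eval_C]
  constructor
  · rintro ⟨h1, h2⟩
    exact mul_pos (sub_pos.2 h1) (sub_pos.2 h2)
  · intro h
    have h1 : a < x := by
      by_contra hx
      have h' : (x - a) * (b - x) ≤ 0 := mul_nonpos_of_nonpos_of_nonneg (sub_nonpos.2 (not_lt.1 hx)) (sub_nonneg.2 ((not_lt.1 hx).trans hab))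
      exact absurd h (not_lt.2 h')
    exact ⟨h1, sub_pos.1 ((mul_pos_iff_of_pos_left (sub_pos.2 h1)).1 h)⟩

/-- **`Q` non-vanishing on the real roots ⇒ `2·#{x ∈ roots_ℝ(P) | Q(x) > 0} = Sign H_t(P′/P) + Sign H_t(Q·P′/P)`** (`TaQ(1, P) + TaQ(Q, P)`; `P` monic real, `deg P ≤ t + 1`). [this file, §716] -/
theorem two_mul_card_roots_filter_pos_eq_of_forall_ne {t : ℕ} {P : ℝ[X]} (hP : P.Monic) (hPd : P.natDegree ≤ t + 1) {Q : ℝ[X]} (hQ : ∀ x ∈ P.roots, Q.eval x ≠ 0) :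
    (2 * (P.roots.toFinset.filter fun x => 0 < Q.eval x).card : ℤ)
      = ((sigPos (hankelSq ℝ t (dualSeq ℝ P (derivative P))).toQuadraticForm' : ℤ) - sigNeg (hankelSq ℝ t (dualSeq ℝ P (derivative P))).toQuadraticForm')
        + ((sigPos (hankelSq ℝ t (dualSeq ℝ P (Q * derivative P))).toQuadraticForm' : ℤ) - sigNeg (hankelSq ℝ t (dualSeq ℝ P (Q * derivative P))).toQuadraticForm') := by
  rw [sigPos_sub_sigNeg_hankelSq_dualSeq_derivative_real hP hPd, sigPos_sub_sigNeg_hankelSq_dualSeq_mul_derivative_real hP hPd, Finset.card_eq_sum_ones P.roots.toFinset, Nat.cast_sum,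
    ← Finset.sum_add_distrib, Finset.card_filter, Nat.cast_sum, Finset.mul_sum]
  refine Finset.sum_congr rfl fun x hx => ?_
  rw [Nat.cast_one, one_add_sign_of_ne_zero (hQ x (Multiset.mem_toFinset.1 hx))]
  split_ifs <;> simp

/-- **Roots to the right of `a`: `P(a) ≠ 0 ⇒ 2·#{x ∈ roots_ℝ(P) | a < x} = Sign H_t(P′/P) + Sign H_t((X − a)·P′/P)`** (`P` monic real, `deg P ≤ t + 1`). [this file, §716] -/
theorem two_mul_card_roots_Ioi_eq {t : ℕ} {P : ℝ[X]} (hP : P.Monic) (hPd : P.natDegree ≤ t + 1) {a : ℝ} (ha : P.eval a ≠ 0) :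
    (2 * (P.roots.toFinset.filter fun x => a < x).card : ℤ)
      = ((sigPos (hankelSq ℝ t (dualSeq ℝ P (derivative P))).toQuadraticForm' : ℤ) - sigNeg (hankelSq ℝ t (dualSeq ℝ P (derivative P))).toQuadraticForm')
        + ((sigPos (hankelSq ℝ t (dualSeq ℝ P ((Polynomial.X - C a) * derivative P))).toQuadraticForm' : ℤ) - sigNeg (hankelSq ℝ t (dualSeq ℝ P ((Polynomial.X - C a) * derivative P))).toQuadraticForm') := by
  have hQ : ∀ x ∈ P.roots, (Polynomial.X - C a).eval x ≠ 0 := fun x hx h => by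
    rw [eval_sub, eval_X, eval_C, sub_eq_zero] at h
    exact ha (by rw [← h]; exact (Polynomial.mem_roots hP.ne_zero).1 hx)
  rw [← two_mul_card_roots_filter_pos_eq_of_forall_ne hP hPd hQ]
  congr 3
  exact Finset.filter_congr fun x _ => by rw [eval_sub, eval_X, eval_C, sub_pos]

/-- **Roots to the left of `a`: `P(a) ≠ 0 ⇒ 2·#{x ∈ roots_ℝ(P) | x < a} = Sign H_t(P′/P) + Sign H_t((a − X)·P′/P)`.** [this file, §716] -/
theorem two_mul_card_roots_Iio_eq {t : ℕ} {P : ℝ[X]} (hP : P.Monic) (hPd : P.natDegree ≤ t + 1) {a : ℝ} (ha : P.eval a ≠ 0) :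
    (2 * (P.roots.toFinset.filter fun x => x < a).card : ℤ)
      = ((sigPos (hankelSq ℝ t (dualSeq ℝ P (derivative P))).toQuadraticForm' : ℤ) - sigNeg (hankelSq ℝ t (dualSeq ℝ P (derivative P))).toQuadraticForm')
        + ((sigPos (hankelSq ℝ t (dualSeq ℝ P ((C a - Polynomial.X) * derivative P))).toQuadraticForm' : ℤ) - sigNeg (hankelSq ℝ t (dualSeq ℝ P ((C a - Polynomial.X) * derivative P))).toQuadraticForm') := by
  have hQ : ∀ x ∈ P.roots, (C a - Polynomial.X).eval x ≠ 0 := fun x hx h => by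
    rw [eval_sub, eval_X, eval_C, sub_eq_zero] at h
    exact ha (by rw [h]; exact (Polynomial.mem_roots hP.ne_zero).1 hx)
  rw [← two_mul_card_roots_filter_pos_eq_of_forall_ne hP hPd hQ]
  congr 3
  exact Finset.filter_congr fun x _ => by rw [eval_sub, eval_X, eval_C, sub_pos]

end Summit.Ventures.HSemireg.Wedge.HankelOuter
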